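import Summits.Ventures.Crystal3D.LocalLP.IsoFederer
import Summits.Ventures.Crystal3D.LocalLP.IsoDensity
import Literature.Geometry.DiscreteGeometry.IsoperimetricUnionBallsProof
import HarnessLib

/-!
# The classical inputs discharged: the `1.67` rung, Bezdek–Reid's `0.926`, and the isoperimetric input `(I)` unconditionally

Venture `Crystal3D` (cell `pub-crystal3d`, seat p3). Both classical named facts of the surface-bound ladder are now
THEOREMS of the tree: `Schmidt1948_sphericalIsoperimetric_holds` (Lévy–Schmidt spherical isoperimetric inequality;
seat lit-2, `SphericalIsoperimetricProof.lean`) and `Federer1969_isoperimetricUnionBalls_holds` (isoperimetric inequality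
for finite unions of balls in `ℝ³`; seat lit-2, `IsoperimetricUnionBallsProof.lean`). This file composes them with the
landed conditional chain (`IsoFederer.lean`, `IsoDensity.lean`, `LevyHeadline.lean`):

* `isoInput_holds` / `isoInput_one_holds` — input `(I)`: `IsoInput r (1/(4r²))` for every `r ≥ 1/2`, unconditionally;
* **`surfaceBound_levy_holds : SurfaceBound (167/100)`** — every packing of `N ≥ 2` diameter-`1` balls in `ℝ³` has fewer
  than `6N − 1.67 N^{2/3}` contacts: a CLOSED theorem (trust base: the three standard axioms), with the unfolded forms
  `numContacts_lt_levy`, `maxContacts_lt_levy`;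
* **`bezdekReidBound_holds : BezdekReidBound`** (`SurfaceBound 0.926`, the printed Bezdek–Reid 2013 constant) and the
  Literature statement itself, **`bezdekReid2013_contactNumber_lt_holds : BezdekReid2013_contactNumber_lt`** (radius-`1`
  form, via the `RadiusOne` scaling bridge) — Bezdek–Reid's Theorem 1 (i) is thereby PROVED in the tree (by the Lévy route,
  not by the printed dodecahedral route);
* the cell's higher rungs with the Federer binder removed: `surfaceBound_H1_of_capTable : LevyCapInput 1 FH1 →
  SurfaceBound (23/10)`, `surfaceBound_H1K_of_capTable : LevyCapInput 1 FH1 → Bezdek2002_doubledBallsUnion →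
  SurfaceBound (281/100)`, `surfaceBound_H2_of_capTable : flyspeck_L12 → LevyCapInput rH2 FH2 →
  HalesDSP_truncatedDodecahedral → SurfaceBound (79/25)`. Their remaining hypotheses are exactly: the cell's certified
  CELL5 cap tables (`LevyCapInput … FH1/FH2`, engine-2, not a Literature fact) and the named computer-assisted facts
  (Kepler via Bezdek 2002; Hales–McLaughlin dodecahedral bound; Flyspeck `L12`).

HONEST FRAMING: no crystallization statement; `2.3 / 2.81 / 3.16` stay conditional as listed. All decls std axioms.
-/

noncomputable section

namespace Summit.Ventures.Crystal3D

open Literature.Geometry.DiscreteGeometry (Federer1969_isoperimetricUnionBalls_holds BezdekReid2013_contactNumber_lt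
  flyspeck_L12 HalesDSP_truncatedDodecahedral Bezdek2002_doubledBallsUnion IsUnitBallPacking)

variable {N : ℕ}

/-! ### Input `(I)` -/

/-- **Input `(I)`, unconditionally:** for every packing of diameter-`1` balls and every probing radius `r ≥ 1/2`, the total
exposed fraction is at least `N^{2/3}/(4r²)`. [folklore] -/
theorem isoInput_holds {r : ℝ} (hr : 1 / 2 ≤ r) : IsoInput r (1 / (4 * r ^ 2)) :=
  isoInput_of_federer Federer1969_isoperimetricUnionBalls_holds hr

/-- Input `(I)` at probing radius `1`: `IsoInput 1 (1/4)`, unconditionally. [folklore] -/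
theorem isoInput_one_holds : IsoInput 1 (1 / 4) :=
  isoInput_one_of_federer Federer1969_isoperimetricUnionBalls_holds

/-! ### The `1.67` rung and Bezdek–Reid, closed -/

/-- **The Lévy rung, PROVED:** `SurfaceBound (167/100)` — every packing of `N ≥ 2` diameter-`1` balls in `ℝ³` has fewer
than `6N − 1.67 N^{2/3}` contacts. Trust base: none beyond the standard axioms (Lévy–Schmidt and Federer are tree
theorems). [folklore] -/
theorem surfaceBound_levy_holds : SurfaceBound (167 / 100) :=
  surfaceBound_levy_of_federer Federer1969_isoperimetricUnionBalls_holds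

/-- Unfolded: `C(x) < 6N − 1.67 N^{2/3}` for every packing `x` of `N ≥ 2` diameter-`1` balls. [folklore] -/
theorem numContacts_lt_levy (hN : 2 ≤ N) (x : Fin N → EuclideanSpace ℝ (Fin 3)) (hx : IsUnitPacking x) :
    (numContacts x : ℝ) < 6 * N - 167 / 100 * (N : ℝ) ^ ((2 : ℝ) / 3) :=
  surfaceBound_levy_holds N hN x hx

/-- Unfolded for the maximum: `C(N) < 6N − 1.67 N^{2/3}` for `N ≥ 2`. [folklore] -/
theorem maxContacts_lt_levy (hN : 2 ≤ N) : (maxContacts 3 N : ℝ) < 6 * N - 167 / 100 * (N : ℝ) ^ ((2 : ℝ) / 3) := by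
  obtain ⟨x, hx, hxe⟩ := exists_numContacts_eq_maxContacts (d := 3) (by norm_num) N
  rw [← hxe]
  exact numContacts_lt_levy hN x hx

/-- **Bezdek–Reid's printed `0.926`, PROVED** (as the weaker instance of the `1.67` rung). [folklore] -/
theorem bezdekReidBound_holds : BezdekReidBound :=
  bezdekReidBound_of_federer Federer1969_isoperimetricUnionBalls_holds

/-- **Bezdek–Reid 2013, Theorem 1 (i), in the Literature's radius-`1` vocabulary, PROVED:** for every injective labelled
packing `x` of `n ≥ 2` unit balls, `contactNumber x < 6n − 0.926 n^{2/3}`. Obtained from `bezdekReidBound_holds` through the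
`RadiusOne` scaling bridge (`x ↦ x/2`). [cite: BezdekReid2013, Theorem 1 (i)] -/
theorem bezdekReid2013_contactNumber_lt_holds : BezdekReid2013_contactNumber_lt := by
  intro n x hn hinj hP
  set y : Fin n → EuclideanSpace ℝ (Fin 3) := fun i => (1 / 2 : ℝ) • x i with hy
  have h2y : (fun i => (2 : ℝ) • y i) = x := by
    funext i
    rw [hy, smul_smul]
    norm_num
  have hyP : IsUnitPacking y := by
    rw [isUnitPacking_iff_two_smul, h2y]
    exact ⟨hinj, hP⟩
  have h := bezdekReidBound_holds n hn y hyP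
  rwa [numContacts_eq_contactNumber_two_smul, h2y] at h

/-! ### The higher rungs without the Federer binder -/

/-- **H1 (`γ = 2.3`)** from the cell's certified cap table at probing radius `1` alone. [folklore] -/
theorem surfaceBound_H1_of_capTable (hL : LevyCapInput 1 FH1) : SurfaceBound (23 / 10) :=
  surfaceBound_H1_classical hL Federer1969_isoperimetricUnionBalls_holds

/-- **H1′ (`γ = 2.81`)** from the cap table and the Kepler-type doubled-balls bound (Bezdek 2002). [folklore] -/
theorem surfaceBound_H1K_of_capTable (hL : LevyCapInput 1 FH1) (hK : Bezdek2002_doubledBallsUnion) :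
    SurfaceBound (281 / 100) :=
  surfaceBound_H1K_classical hL hK Federer1969_isoperimetricUnionBalls_holds

/-- **H2 (`γ = 3.16`)** from Flyspeck `L12`, the cap table at `rH2`, and the dodecahedral volume bound. [folklore] -/
theorem surfaceBound_H2_of_capTable (hL12 : flyspeck_L12) (hL : LevyCapInput rH2 FH2)
    (hD : HalesDSP_truncatedDodecahedral) : SurfaceBound (79 / 25) :=
  surfaceBound_H2_classical hL12 hL hD Federer1969_isoperimetricUnionBalls_holds

end Summit.Ventures.Crystal3D

end
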